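import Summits.ResolutionOfSingularities.ResolutionOfSingularities.Theses.WildCones

/-!
# `ConeExit` (crux stmt-ResolutionOfSingularities-16883, route `WildCones`):
# `p ≠ 2` is load-bearing in the cone-forcing mechanism — the critical-direction (Chern / Euler–Koszul)
# lemma is FALSE at `p = 2` (negative-side support, refuter cdisprove seat; this file refutes nothing
# stated in the route: `ChernCriticalDirection` and the crux both carry `p ≠ 2`)

The order-`p` clause of `ConeExit` ("`dL ≥ 2` ⇒ no isolated multiplicity-`p` successor") rests on ONE
wild input, the registered stub `stub_chern` = support item `ChernCriticalDirection` (stmt-16885): for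
`p` odd and `s ≥ 2`, every non-zero degree-`p` form in `s` variables over an algebraically closed field
of characteristic `p` has a non-zero critical point (Euler degeneracy `Σ yⱼ ∂ⱼH = p·H = 0`; top Chern
class `((p-1)^s - (-1)^s)/p ≠ 0` of `Ω¹_{ℙ^{s-1}}(p)`).

Here we record, sorry-free, that the parity hypothesis cannot be dropped: at `p = 2`, `s = 2`, the
contact form `H = X₀X₁` (over ANY field, in particular over an algebraically closed field of
characteristic `2`) is homogeneous of degree `2`, non-zero, and `∇H = (X₁, X₀)` vanishes only at the
origin — the Chern number `((p-1)^s - (-1)^s)/p` is `0` exactly for `(p, s) = (2, even)`. This is the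
mechanism behind the planner's `p = 2` counterexample to the crux body (`a = u₁u₂ + u₃²u₄ + u₄⁵ + u₃⁷`,
`n = 4`: an isolated double successor with `dL = 2`), and the reason `ConeExit` is stated for odd `p`
only. Any proof of the crux through cone forcing must use `p ≠ 2` exactly here.
-/

noncomputable section

-- single-problem summit: the doubled namespace component `ResolutionOfSingularities` is forced by the tree layout
set_option linter.dupNamespace false

namespace Summit.ResolutionOfSingularities.ResolutionOfSingularities.Theorems.ConeExit.Negative

open MvPolynomial

/-- **The contact form has no critical direction.** Over any field `k`, `H = X₀X₁ ∈ k[X₀, X₁]` is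
homogeneous of degree `2`, non-zero, and every common zero of `∂₀H = X₁`, `∂₁H = X₀` is `0`. [folklore] -/
theorem contactForm_no_critical_direction (k : Type) [Field k] :
    ∃ H : MvPolynomial (Fin 2) k, H.IsHomogeneous 2 ∧ H ≠ 0 ∧
      ∀ v : Fin 2 → k, (∀ j : Fin 2, eval v (pderiv j H) = 0) → v = 0 := by
  refine ⟨X 0 * X 1, (isHomogeneous_X k 0).mul (isHomogeneous_X k 1),
    mul_ne_zero (X_ne_zero 0) (X_ne_zero 1), ?_⟩
  intro v hv
  have h0 := hv 0
  have h1 := hv 1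
  have d0 : pderiv 0 (X 0 * X 1 : MvPolynomial (Fin 2) k) = X 1 := by
    rw [(pderiv 0).leibniz, pderiv_X_self, pderiv_X_of_ne (by decide : (1 : Fin 2) ≠ 0)]; simp
  have d1 : pderiv 1 (X 0 * X 1 : MvPolynomial (Fin 2) k) = X 0 := by
    rw [(pderiv 1).leibniz, pderiv_X_self, pderiv_X_of_ne (by decide : (0 : Fin 2) ≠ 1)]; simp
  rw [d0, eval_X] at h0
  rw [d1, eval_X] at h1
  funext j
  fin_cases j
  · exact h1
  · exact h0

/-- **`p ≠ 2` is load-bearing in the critical-direction lemma** (`stub_chern` of the registered line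
`critical-plane` = support item `ChernCriticalDirection`, with the hypothesis `p ≠ 2` deleted and
nothing else changed): false at `p = 2`, `s = 2`, `k = \overline{𝔽₂}`, `H = X₀X₁`. [folklore] -/
theorem chernCriticalDirection_false_without_pne2 :
    ¬ ∀ p : ℕ, p.Prime → ∀ (s : ℕ), 2 ≤ s → ∀ (k : Type) [Field k] [CharP k p] [IsAlgClosed k]
        (H : MvPolynomial (Fin s) k), H.IsHomogeneous p → H ≠ 0 →
        ∃ v : Fin s → k, v ≠ 0 ∧ ∀ j : Fin s, eval v (pderiv j H) = 0 := by
  intro h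
  obtain ⟨H, hH, hH0, hcrit⟩ := contactForm_no_critical_direction (AlgebraicClosure (ZMod 2))
  obtain ⟨v, hv0, hv⟩ := h 2 Nat.prime_two 2 le_rfl (AlgebraicClosure (ZMod 2)) H hH hH0
  exact hv0 (hcrit v hv)

/-- The same failure INSIDE the crux's own scope of fields (perfect, characteristic `2`, not
necessarily algebraically closed): over `𝔽₂` itself the contact form has no non-zero critical point,
so no field extension is needed to see the `p = 2` exception. [folklore] -/
theorem contactForm_no_critical_direction_F2 :
    ∀ v : Fin 2 → ZMod 2, (∀ j : Fin 2, eval v (pderiv j (X 0 * X 1 : MvPolynomial (Fin 2) (ZMod 2))) = 0) →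
      v = 0 := by
  intro v hv
  have d0 : pderiv 0 (X 0 * X 1 : MvPolynomial (Fin 2) (ZMod 2)) = X 1 := by
    rw [(pderiv 0).leibniz, pderiv_X_self, pderiv_X_of_ne (by decide : (1 : Fin 2) ≠ 0)]; simp
  have d1 : pderiv 1 (X 0 * X 1 : MvPolynomial (Fin 2) (ZMod 2)) = X 0 := by
    rw [(pderiv 1).leibniz, pderiv_X_self, pderiv_X_of_ne (by decide : (0 : Fin 2) ≠ 1)]; simp
  have h0 := hv 0
  have h1 := hv 1
  rw [d0, eval_X] at h0
  rw [d1, eval_X] at h1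
  funext j
  fin_cases j
  · exact h1
  · exact h0

end Summit.ResolutionOfSingularities.ResolutionOfSingularities.Theorems.ConeExit.Negative

end
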